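import Literature.AnabelianGeometry.SemiGraphs.TreeSystemBoundedGeodesics
import Literature.AnabelianGeometry.SemiGraphs.TemperedLevelData
import Mathlib.Data.Set.Card
import HarnessLib

/-!
# Geodesics in an inverse system of trees: the image of a level geodesic COVERS the lower geodesic,
# base-edge by base-edge ([SemiAnbd] Thm. 3.7 (iii), p. 41)

Mochizuki, *Semi-graphs of anabelioids*, Publ. RIMS **42** (2006), §1 (semi-graphs as topological
spaces, p. 11–13) and §3, Thm. 3.7 (iii), proof p. 41 with the author's *Comments* (2020) (6): the
compact subgroup acts on the inverse system of trees `𝒢_{∞,j} → 𝔾` and compatible systems of fixed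
vertices are compared level by level. [cite: MochizukiSemiAnbd2006, Thm. 3.7(iii) p.41]

PROOF-ONLY tool file (cell abc-iut, block F, FACT-LIST rows F-2772 `EdgeLikeCentralizerAt` /
F-2773 `EdgeLikeCentralizer`, residual «infinite valence» of GAP row G-t6g3-2b; seat abc-iut-f-172 gen 5,
memo `HOME/staging/f/f-172/gen5/RETRACTION-STAR-F2773-memo.md` §2 (S1); no definition, nothing specific
to anabelioids).  The currency is that of abc-iut-w5-d160's `TreeSystemBoundedGeodesics.lean`
(`dist_le_dist_of_compatible`: level distances of compatible vertex systems are non-decreasing).  Here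
the non-decrease is refined from the LENGTH of the level geodesic to its CONTENT:

* `SemiGraph.exists_mem_support_map_eq_of_mem_geodesic` — for a morphism `φ : G ⟶ G'` to a semi-graph
  with acyclic subdivision, ANY walk `p : a ⇝ b` of the subdivision of `G` and the geodesic
  `q : φ a ⇝ φ b` of `G'`: every node of `q` is the image of a node of `p` (the image walk, bypassed to a
  path, IS `q` — `Walk.bypass` + `IsAcyclic.path_unique`); vertex / edge / branch forms
  `exists_vertex_…`, `exists_edge_…`, `exists_branch_mem_support_of_mem_geodesic`;
* `SemiGraph.ncard_edges_geodesic_le` — hence for any labelling of edges compatible with `φ` (e.g. the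
  projections to a base semi-graph `𝔾`) and any label `t`, the number of edges of `q` with label `t` is
  AT MOST the number of edges of `p` with label `t`;
* system forms `SemiGraph.ncard_edges_geodesic_mono`, `SemiGraph.exists_edge_geodesic_of_le` — for
  compatible vertex systems `x`, `x'` of an inverse system of trees with compatibly labelled edges, the
  number `N_t(j)` of edges with label `t` on the level-`j` geodesic `[x j, x' j]` is NON-DECREASING in
  `j`, and a label met at one level is met at every higher level;
* `ProfiniteSemiGraph.VerticialLevelData.ncard_geodesicEdges_over_mono` /
  `exists_geodesicEdge_over_of_le` — the same over the level data of a chart, labels := base edges of `𝔾`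
  via `D.proj` (so: the SET of edges of `𝔾` over which an escaping pair of fixed systems travels only
  GROWS with the level, each multiplicity included).

Use (memo §2): for a compact `C` and an escaping `C`-fixed pair `(x, g·x)` this sorts the escape into
«confined over one closed edge» versus «a foreign base edge persists», the trichotomy behind the
infinite-valence residual of F-2772/F-2773.  Nothing here bears on [IUTchIII] Cor. 3.12; no row of
plan/FACT-LIST is asserted; typed ≠ proved elsewhere.
-/

namespace Literature.AnabelianGeometry.SemiGraphs

namespace SemiGraph

open CategoryTheory

universe v u

/-! ### The image of a walk covers the geodesic between the images of its ends -/

section Image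

variable {G G' : SemiGraph.{u}}

/-- **The image walk covers the geodesic.**  Let `φ : G ⟶ G'` with `G'` of acyclic subdivision, `p` any
walk of the subdivision of `G` between two vertex-points `a`, `b`, and `q` the geodesic (a path) of `G'`
from `φ a` to `φ b`.  Then every node of `q` is the image under `φ` of a node ON `p`: the image of `p` is a
walk from `φ a` to `φ b`, its bypass is a path with the same ends, and paths in an acyclic graph are
unique. [cite: MochizukiSemiAnbd2006, Thm. 3.7(iii) p.41] -/
theorem exists_mem_support_map_eq_of_mem_geodesic (hG' : G'.subdivision.IsAcyclic) (φ : G ⟶ G')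
    {a b : G.Vertex} (p : G.subdivision.Walk (Sum.inl a) (Sum.inl b))
    (q : G'.subdivision.Walk (Sum.inl (φ.vertexMap a)) (Sum.inl (φ.vertexMap b))) (hq : q.IsPath)
    {z : G'.Node} (hz : z ∈ q.support) :
    ∃ z' ∈ p.support, Sum.map φ.vertexMap (Sum.map φ.edgeMap φ.branchMap) z' = z := by
  classical
  let Φ : G.subdivision →g G'.subdivision :=
    ⟨Sum.map φ.vertexMap (Sum.map φ.edgeMap φ.branchMap), fun h => subdivision_adj_map φ h⟩
  have e₁ : Φ (Sum.inl a) = Sum.inl (φ.vertexMap a) := rfl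
  have e₂ : Φ (Sum.inl b) = Sum.inl (φ.vertexMap b) := rfl
  let W : G'.subdivision.Walk (Sum.inl (φ.vertexMap a)) (Sum.inl (φ.vertexMap b)) :=
    (p.map Φ).copy e₁ e₂
  have hb : W.bypass = q :=
    congrArg Subtype.val (hG'.path_unique ⟨W.bypass, W.bypass_isPath⟩ ⟨q, hq⟩)
  have hzW : z ∈ W.support := W.support_bypass_subset_support (by rw [hb]; exact hz)
  have hWs : W.support = (p.map Φ).support := SimpleGraph.Walk.support_copy _ _ _
  rw [hWs, SimpleGraph.Walk.support_map] at hzW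
  obtain ⟨z', hz', rfl⟩ := List.mem_map.1 hzW
  exact ⟨z', hz', rfl⟩

/-- **Vertex form**: every vertex on the geodesic `φ a ⇝ φ b` of the tree-like `G'` is the image of a
vertex on any walk `a ⇝ b` of `G`. [cite: MochizukiSemiAnbd2006, Thm. 3.7(iii) p.41] -/
theorem exists_vertex_mem_support_of_mem_geodesic (hG' : G'.subdivision.IsAcyclic) (φ : G ⟶ G')
    {a b : G.Vertex} (p : G.subdivision.Walk (Sum.inl a) (Sum.inl b))
    (q : G'.subdivision.Walk (Sum.inl (φ.vertexMap a)) (Sum.inl (φ.vertexMap b))) (hq : q.IsPath)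
    {v' : G'.Vertex} (hv' : (Sum.inl v' : G'.Node) ∈ q.support) :
    ∃ v : G.Vertex, (Sum.inl v : G.Node) ∈ p.support ∧ φ.vertexMap v = v' := by
  obtain ⟨z', hz', hz'e⟩ := exists_mem_support_map_eq_of_mem_geodesic hG' φ p q hq hv'
  rcases z' with v | e | c
  · exact ⟨v, hz', by simpa using hz'e⟩
  · simp at hz'e
  · simp at hz'e

/-- **Edge form**: every edge on the geodesic `φ a ⇝ φ b` of the tree-like `G'` is the image of an EDGE
on any walk `a ⇝ b` of `G`. [cite: MochizukiSemiAnbd2006, Thm. 3.7(iii) p.41] -/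
theorem exists_edge_mem_support_of_mem_geodesic (hG' : G'.subdivision.IsAcyclic) (φ : G ⟶ G')
    {a b : G.Vertex} (p : G.subdivision.Walk (Sum.inl a) (Sum.inl b))
    (q : G'.subdivision.Walk (Sum.inl (φ.vertexMap a)) (Sum.inl (φ.vertexMap b))) (hq : q.IsPath)
    {e' : G'.Edge} (he' : (Sum.inr (Sum.inl e') : G'.Node) ∈ q.support) :
    ∃ e : G.Edge, (Sum.inr (Sum.inl e) : G.Node) ∈ p.support ∧ φ.edgeMap e = e' := by
  obtain ⟨z', hz', hz'e⟩ := exists_mem_support_map_eq_of_mem_geodesic hG' φ p q hq he'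
  rcases z' with v | e | c
  · simp at hz'e
  · exact ⟨e, hz', by simpa using hz'e⟩
  · simp at hz'e

/-- **Branch form**: every branch on the geodesic `φ a ⇝ φ b` of the tree-like `G'` is the image of a
branch on any walk `a ⇝ b` of `G`. [cite: MochizukiSemiAnbd2006, Thm. 3.7(iii) p.41] -/
theorem exists_branch_mem_support_of_mem_geodesic (hG' : G'.subdivision.IsAcyclic) (φ : G ⟶ G')
    {a b : G.Vertex} (p : G.subdivision.Walk (Sum.inl a) (Sum.inl b))
    (q : G'.subdivision.Walk (Sum.inl (φ.vertexMap a)) (Sum.inl (φ.vertexMap b))) (hq : q.IsPath)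
    {c' : G'.Branch} (hc' : (Sum.inr (Sum.inr c') : G'.Node) ∈ q.support) :
    ∃ c : G.Branch, (Sum.inr (Sum.inr c) : G.Node) ∈ p.support ∧ φ.branchMap c = c' := by
  obtain ⟨z', hz', hz'e⟩ := exists_mem_support_map_eq_of_mem_geodesic hG' φ p q hq hc'
  rcases z' with v | e | c
  · simp at hz'e
  · simp at hz'e
  · exact ⟨c, hz', by simpa using hz'e⟩

/-- The edges lying on a walk of the subdivision form a finite set (the support is a finite list).
[cite: MochizukiSemiAnbd2006, §1 p.11] -/
theorem finite_edges_mem_support {x y : G.Node} (p : G.subdivision.Walk x y) :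
    {e : G.Edge | (Sum.inr (Sum.inl e) : G.Node) ∈ p.support}.Finite := by
  have h0 : {z : G.Node | z ∈ p.support}.Finite := p.support.finite_toSet
  exact h0.preimage fun e₁ _ e₂ _ h => by simpa using h

/-- **Label counts along geodesics do not increase under a morphism.**  With `φ`, `p`, `q` as in
`exists_edge_mem_support_of_mem_geodesic`, let `ℓ`, `ℓ'` be labellings of the edges of `G`, `G'` by any
type, compatible with `φ` (e.g. the projections to a common base semi-graph).  Then for every label `t`
the number of edges of the geodesic `q` carrying `t` is at most the number of edges of the walk `p`
carrying `t` (the former set lies in the `φ`-image of the latter).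
[cite: MochizukiSemiAnbd2006, Thm. 3.7(iii) p.41] -/
theorem ncard_edges_geodesic_le (hG' : G'.subdivision.IsAcyclic) (φ : G ⟶ G')
    {a b : G.Vertex} (p : G.subdivision.Walk (Sum.inl a) (Sum.inl b))
    (q : G'.subdivision.Walk (Sum.inl (φ.vertexMap a)) (Sum.inl (φ.vertexMap b))) (hq : q.IsPath)
    {β : Type*} (ℓ : G.Edge → β) (ℓ' : G'.Edge → β) (hℓ : ∀ e, ℓ' (φ.edgeMap e) = ℓ e) (t : β) :
    {e' : G'.Edge | (Sum.inr (Sum.inl e') : G'.Node) ∈ q.support ∧ ℓ' e' = t}.ncard ≤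
      {e : G.Edge | (Sum.inr (Sum.inl e) : G.Node) ∈ p.support ∧ ℓ e = t}.ncard := by
  have hS : {e : G.Edge | (Sum.inr (Sum.inl e) : G.Node) ∈ p.support ∧ ℓ e = t}.Finite :=
    (finite_edges_mem_support p).subset fun e he => he.1
  have hsub : {e' : G'.Edge | (Sum.inr (Sum.inl e') : G'.Node) ∈ q.support ∧ ℓ' e' = t} ⊆
      φ.edgeMap '' {e : G.Edge | (Sum.inr (Sum.inl e) : G.Node) ∈ p.support ∧ ℓ e = t} := by
    rintro e' ⟨he', hte'⟩
    obtain ⟨e, he, hee'⟩ := exists_edge_mem_support_of_mem_geodesic hG' φ p q hq he'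
    refine ⟨e, ⟨he, ?_⟩, hee'⟩
    rw [← hℓ e, hee', hte']
  exact (Set.ncard_le_ncard hsub (hS.image _)).trans (Set.ncard_image_le hS)

end Image

/-! ### Systems of trees: the content of the level geodesics is non-decreasing -/

section System

variable {J : Type v} [Preorder J]

/-- **Label counts along level geodesics are non-decreasing.**  For an inverse system of trees `T j`
with transition morphisms `f : T j ⟶ T i` (`i ≤ j`), edges labelled compatibly (`ℓ i (f e) = ℓ j e`;
e.g. by the edges of a common base `𝔾`), and two COMPATIBLE vertex systems `x`, `x'`: for `i ≤ j` and
every label `t`, the level-`i` geodesic `[x i, x' i]` has at most as many edges labelled `t` as the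
level-`j` geodesic `[x j, x' j]` (any path `qi`, any walk `qj`).  Refines abc-iut-w5-d160's
`dist_le_dist_of_compatible`. [cite: MochizukiSemiAnbd2006, Thm. 3.7(iii) p.41] -/
theorem ncard_edges_geodesic_mono (T : J → SemiGraph.{u}) (hT : ∀ j, (T j).IsTree)
    (f : ∀ ⦃i j : J⦄, i ≤ j → (T j ⟶ T i)) {β : Type*} (ℓ : ∀ j, (T j).Edge → β)
    (hℓ : ∀ ⦃i j : J⦄ (h : i ≤ j) (e : (T j).Edge), ℓ i ((f h).edgeMap e) = ℓ j e)
    (x x' : ∀ j, (T j).Vertex)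
    (hx : ∀ ⦃i j : J⦄ (h : i ≤ j), (f h).vertexMap (x j) = x i)
    (hx' : ∀ ⦃i j : J⦄ (h : i ≤ j), (f h).vertexMap (x' j) = x' i) ⦃i j : J⦄ (h : i ≤ j)
    (qi : (T i).subdivision.Walk (Sum.inl (x i)) (Sum.inl (x' i))) (hqi : qi.IsPath)
    (qj : (T j).subdivision.Walk (Sum.inl (x j)) (Sum.inl (x' j))) (t : β) :
    {e : (T i).Edge | (Sum.inr (Sum.inl e) : (T i).Node) ∈ qi.support ∧ ℓ i e = t}.ncard ≤
      {e : (T j).Edge | (Sum.inr (Sum.inl e) : (T j).Node) ∈ qj.support ∧ ℓ j e = t}.ncard := by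
  let qi' : (T i).subdivision.Walk (Sum.inl ((f h).vertexMap (x j))) (Sum.inl ((f h).vertexMap (x' j))) :=
    qi.copy (by rw [hx h]) (by rw [hx' h])
  have hqi' : qi'.IsPath := by simpa only [qi', SimpleGraph.Walk.isPath_copy] using hqi
  have h1 := ncard_edges_geodesic_le (hT i).isTree.isAcyclic (f h) qj qi' hqi' (ℓ j) (ℓ i) (hℓ h) t
  simpa only [qi', SimpleGraph.Walk.support_copy] using h1

/-- **A label met at one level is met at every higher level** (with a preimage edge): if the level-`i`
geodesic `[x i, x' i]` passes an edge `e`, then for every `j ≥ i` the level-`j` geodesic passes an edge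
`e'` with `f e' = e`. [cite: MochizukiSemiAnbd2006, Thm. 3.7(iii) p.41] -/
theorem exists_edge_geodesic_of_le (T : J → SemiGraph.{u}) (hT : ∀ j, (T j).IsTree)
    (f : ∀ ⦃i j : J⦄, i ≤ j → (T j ⟶ T i)) (x x' : ∀ j, (T j).Vertex)
    (hx : ∀ ⦃i j : J⦄ (h : i ≤ j), (f h).vertexMap (x j) = x i)
    (hx' : ∀ ⦃i j : J⦄ (h : i ≤ j), (f h).vertexMap (x' j) = x' i) ⦃i j : J⦄ (h : i ≤ j)
    (qi : (T i).subdivision.Walk (Sum.inl (x i)) (Sum.inl (x' i))) (hqi : qi.IsPath)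
    (qj : (T j).subdivision.Walk (Sum.inl (x j)) (Sum.inl (x' j)))
    {e : (T i).Edge} (he : (Sum.inr (Sum.inl e) : (T i).Node) ∈ qi.support) :
    ∃ e' : (T j).Edge, (Sum.inr (Sum.inl e') : (T j).Node) ∈ qj.support ∧ (f h).edgeMap e' = e := by
  let qi' : (T i).subdivision.Walk (Sum.inl ((f h).vertexMap (x j))) (Sum.inl ((f h).vertexMap (x' j))) :=
    qi.copy (by rw [hx h]) (by rw [hx' h])
  have hqi' : qi'.IsPath := by simpa only [qi', SimpleGraph.Walk.isPath_copy] using hqi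
  have he' : (Sum.inr (Sum.inl e) : (T i).Node) ∈ qi'.support := by
    simpa only [qi', SimpleGraph.Walk.support_copy] using he
  exact exists_edge_mem_support_of_mem_geodesic (hT i).isTree.isAcyclic (f h) qj qi' hqi' he'

/-- **Vertex form along the system**: every vertex of the level-`i` geodesic is the image of a vertex of
the level-`j` geodesic, `i ≤ j`. [cite: MochizukiSemiAnbd2006, Thm. 3.7(iii) p.41] -/
theorem exists_vertex_geodesic_of_le (T : J → SemiGraph.{u}) (hT : ∀ j, (T j).IsTree)
    (f : ∀ ⦃i j : J⦄, i ≤ j → (T j ⟶ T i)) (x x' : ∀ j, (T j).Vertex)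
    (hx : ∀ ⦃i j : J⦄ (h : i ≤ j), (f h).vertexMap (x j) = x i)
    (hx' : ∀ ⦃i j : J⦄ (h : i ≤ j), (f h).vertexMap (x' j) = x' i) ⦃i j : J⦄ (h : i ≤ j)
    (qi : (T i).subdivision.Walk (Sum.inl (x i)) (Sum.inl (x' i))) (hqi : qi.IsPath)
    (qj : (T j).subdivision.Walk (Sum.inl (x j)) (Sum.inl (x' j)))
    {w : (T i).Vertex} (hw : (Sum.inl w : (T i).Node) ∈ qi.support) :
    ∃ w' : (T j).Vertex, (Sum.inl w' : (T j).Node) ∈ qj.support ∧ (f h).vertexMap w' = w := by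
  let qi' : (T i).subdivision.Walk (Sum.inl ((f h).vertexMap (x j))) (Sum.inl ((f h).vertexMap (x' j))) :=
    qi.copy (by rw [hx h]) (by rw [hx' h])
  have hqi' : qi'.IsPath := by simpa only [qi', SimpleGraph.Walk.isPath_copy] using hqi
  have hw' : (Sum.inl w : (T i).Node) ∈ qi'.support := by
    simpa only [qi', SimpleGraph.Walk.support_copy] using hw
  exact exists_vertex_mem_support_of_mem_geodesic (hT i).isTree.isAcyclic (f h) qj qi' hqi' hw'

end System

end SemiGraph

/-! ### Over the level data of a chart: base edges of `𝔾` along the level geodesics -/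

namespace ProfiniteSemiGraph

namespace VerticialLevelData

open CategoryTheory

universe v u

variable {𝒢 : ProfiniteSemiGraph.{u}} {c : TemperedPiChart 𝒢} (D : VerticialLevelData.{v} 𝒢 c)

/-- The transition maps of the level data respect the projections to `𝔾` on edges.
[cite: MochizukiSemiAnbd2006, Thm. 3.7(iii) p.41] -/
theorem proj_edgeMap_trans ⦃i j : D.J⦄ (h : i ≤ j) (e : (D.tree j).Edge) :
    (D.proj i).edgeMap ((D.trans h).edgeMap e) = (D.proj j).edgeMap e := by
  have h1 := congrArg (fun φ => SemiGraph.Hom.edgeMap φ e) (D.trans_over h)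
  simpa only [SemiGraph.comp_edgeMap, Function.comp_apply] using h1

/-- **The base edges travelled by a compatible pair of vertex systems only accumulate.**  Over the level
data `D` of a chart, for compatible vertex systems `x`, `x'` of the trees `𝒢_{∞,j}`, `i ≤ j`, and every
edge `ē` of `𝔾`: the level-`i` geodesic `[x i, x' i]` has at most as many edges over `ē` as the level-`j`
geodesic `[x j, x' j]`. [cite: MochizukiSemiAnbd2006, Thm. 3.7(iii) p.41] -/
theorem ncard_geodesicEdges_over_mono (x x' : ∀ j, (D.tree j).Vertex)
    (hx : ∀ ⦃i j : D.J⦄ (h : i ≤ j), (D.trans h).vertexMap (x j) = x i)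
    (hx' : ∀ ⦃i j : D.J⦄ (h : i ≤ j), (D.trans h).vertexMap (x' j) = x' i) ⦃i j : D.J⦄ (h : i ≤ j)
    (qi : (D.tree i).subdivision.Walk (Sum.inl (x i)) (Sum.inl (x' i))) (hqi : qi.IsPath)
    (qj : (D.tree j).subdivision.Walk (Sum.inl (x j)) (Sum.inl (x' j))) (ē : 𝒢.graph.Edge) :
    {e : (D.tree i).Edge | (Sum.inr (Sum.inl e) : (D.tree i).Node) ∈ qi.support ∧
        (D.proj i).edgeMap e = ē}.ncard ≤
      {e : (D.tree j).Edge | (Sum.inr (Sum.inl e) : (D.tree j).Node) ∈ qj.support ∧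
        (D.proj j).edgeMap e = ē}.ncard :=
  SemiGraph.ncard_edges_geodesic_mono D.tree D.isTree D.trans (fun j => (D.proj j).edgeMap)
    (fun _ _ h e => D.proj_edgeMap_trans h e) x x' hx hx' h qi hqi qj ē

/-- **A base edge met by the level-`i` geodesic is met by every higher level geodesic** (with an edge
mapping to the given one). [cite: MochizukiSemiAnbd2006, Thm. 3.7(iii) p.41] -/
theorem exists_geodesicEdge_over_of_le (x x' : ∀ j, (D.tree j).Vertex)
    (hx : ∀ ⦃i j : D.J⦄ (h : i ≤ j), (D.trans h).vertexMap (x j) = x i)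
    (hx' : ∀ ⦃i j : D.J⦄ (h : i ≤ j), (D.trans h).vertexMap (x' j) = x' i) ⦃i j : D.J⦄ (h : i ≤ j)
    (qi : (D.tree i).subdivision.Walk (Sum.inl (x i)) (Sum.inl (x' i))) (hqi : qi.IsPath)
    (qj : (D.tree j).subdivision.Walk (Sum.inl (x j)) (Sum.inl (x' j)))
    {e : (D.tree i).Edge} (he : (Sum.inr (Sum.inl e) : (D.tree i).Node) ∈ qi.support) :
    ∃ e' : (D.tree j).Edge, (Sum.inr (Sum.inl e') : (D.tree j).Node) ∈ qj.support ∧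
      (D.trans h).edgeMap e' = e ∧ (D.proj j).edgeMap e' = (D.proj i).edgeMap e := by
  obtain ⟨e', he', hee'⟩ :=
    SemiGraph.exists_edge_geodesic_of_le D.tree D.isTree D.trans x x' hx hx' h qi hqi qj he
  exact ⟨e', he', hee', by rw [← D.proj_edgeMap_trans h e', hee']⟩

end VerticialLevelData

end ProfiniteSemiGraph

end Literature.AnabelianGeometry.SemiGraphs
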